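import Literature.Probability.RandomPlanarGeometry.TwoSidedWholePlaneSLEProofs
import Literature.Probability.RandomPlanarGeometry.TwoSidedWholePlaneSLEStationarity
import HarnessLib

/-!
# Reversibility of two-sided whole-plane SLE_κ (Zhan (2021), §2.2 (i)): the corrected statement and its reductions

Topic `Probability/RandomPlanarGeometry`; sequel to `TwoSidedWholePlaneSLEProofs` (the parametrisation
layer of the transfer) and `TwoSidedWholePlaneSLEStationarity` (the corrected predicates
`IsTwoSidedWholePlaneSLEPairMeas` / `IsTwoSidedWholePlaneSLENatLawMeas`), accompanying the named fact
`IsTwoSidedWholePlaneSLENatLaw.map_reversePath` of `TwoSidedWholePlaneSLE`.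

**The source.** Zhan (2021), §2.2: "From the resampling property of two-sided radial SLE_κ, and the
reversibility of whole-plane SLE_κ(2) and chordal SLE_κ ([MS3, MS4, Zhan 2008]) we know that two-sided
whole-plane SLE satisfies the following two types of reversibility properties. Suppose `γ` is a
whole-plane SLE_κ curve from `a` to `a` through `b`. Then (i) the reversal of `γ` has the same law
(modulo a time change) as `γ`." Transferred to the Minkowski content parametrisation rooted at the
marked point (Rem. 2.4, proof of Cor. 4.7: the parametrisation `𝒫(γ)` with `𝒫(γ)(0) = 0` is unique,
and the reversal of a naturally parametrised path rooted at `0` is again one), (i) says that the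
natural law `ν̂^#_{∞⇌0}` is invariant under `reversePath : γ̂ ↦ γ̂(-·)`.

**The statement is corrected, not discharged (verdict of the reviewing seat: misstated).** As recorded
in `TwoSidedWholePlaneSLEStationarity` and `TwoSidedWholePlaneSLEScaling` for the sibling facts
`…map_reroot` / `…map_dilatePath`, the pair predicate `IsTwoSidedWholePlaneSLEPair` underlying
`IsTwoSidedWholePlaneSLENatLaw` allows a NON-MEASURABLE selector `Φ` of the uniformizer of the remaining
domain, so that — granted existence of the two-sided curve — the class
`{μ | IsTwoSidedWholePlaneSLENatLaw κ μ}` is strictly larger than the one law `ν̂^#_{∞⇌0}` the source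
speaks about (on a suitably enlarged probability space the dilation factor hidden in `Φ(η₁)` is almost
surely a prescribed functional of the driving path, and the second arm is then, given the first, NOT a
chordal SLE_κ). `IsTwoSidedWholePlaneSLENatLaw.map_reversePath` quantifies over that larger class and is
therefore stronger than Zhan (2021), §2.2 (i) — and, like `…unique` and `…map_reroot`, it FAILS granted
existence (of a measurably uniformized pair with its natural parametrisation, `μ₀ := ν̂^#_{∞⇌0}`).
Sketch: in the coordinates `(η₁, W̃)` — first arm, and driving path of the second arm pulled back by a
fixed measurable selector `Φ₀` — `μ₀` corresponds to `P₀ := Law(η₁) ⊗ Wiener`, and the larger class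
contains (by the enlargement above, with dilation factor `2` on an event `A` of `(η₁, W)` and `1` off
`A`) the laws with density `1_{Aᶜ} + 1_{S(A)}` with respect to `P₀`, where `S := id × (W ↦ 2 W(·/4))`
is measure preserving (Brownian scaling) and aperiodic. The loop determines `(η₁, W̃)` (capacity
re-timing of the arms), so path reversal acts on these coordinates by an involution `R̃`, which
preserves `P₀` as soon as `μ₀` is reversal invariant. Invariance of the law with density
`1_{Bᶜ} + 1_{S(B)}` for a wandering set `B` (`B ∩ S(B) = ∅`; every measurable subset of `B` is again
wandering) forces `B`, hence each of its measurable subsets, to be `R̃`-invariant, i.e. `R̃ = id` a.e.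
on `B`; by the Rokhlin lemma wandering sets `B ∪ S(B)` exhaust `P₀`, so `R̃ = id` a.e.: almost surely
the reversed loop would coincide with the loop, the second arm retracing the first inside the
complement of the first — absurd. (Not formalised; recorded for the reviewing trail, as the ergodicity
remark of `TwoSidedWholePlaneSLEStationarity`.) The corrected statement is the same conclusion over
the measurably uniformized class `IsTwoSidedWholePlaneSLENatLawMeas κ`; it is recorded here as the
CONCLUSION of the proved implication `IsTwoSidedWholePlaneSLENatLaw.map_reversePath_imp_meas` (the
misstated fact implies the corrected one, the corrected class being smaller), exactly as
`…map_reroot_imp_meas` and `…map_dilatePath_imp_meas` do; the named fact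
`IsTwoSidedWholePlaneSLENatLawMeas.map_reversePath` itself is left to a definition proposal (a proving or
reviewing seat may not mint it, D-0026). Even corrected, the fact rests on the reversibility of
whole-plane SLE_κ(ρ) (Miller–Sheffield, *Imaginary geometry IV*, Thm 1.20), of chordal SLE_κ
(Zhan (2008); Miller–Sheffield, *Imaginary geometry III*) and on the resampling property of two-sided
radial SLE_κ — none of which is in the tree.

**What is proved (the formal skeleton of the transfer, corrected class).**
* `IsTwoSidedWholePlaneSLENatLawMeas.map_reversePath_of_unique_of_closed`, converse
  `…closed_of_map_reversePath_meas`, and `…map_reversePath_meas_iff_closed_of_unique`: granted the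
  well-definedness of the corrected natural law, corrected reversibility is EXACTLY the closure of the
  corrected class under `reversePath` (the reversed loop, re-timed by Minkowski content from its root,
  is again a two-sided whole-plane SLE_κ natural law).
* `isTwoSidedWholePlaneSLENatLawMeas_map_reversePath_of_reversedPair` and
  `IsTwoSidedWholePlaneSLENatLawMeas.map_reversePath_of_reversedPairs`: the closure, hence corrected
  reversibility, from reversibility AT THE LEVEL OF ARMS — if the reversed arms of a measurably
  uniformized pair, re-timed, form again a measurably uniformized pair on the same space (Zhan's (i)
  before parametrisation: hypothesis `hrev`), then `t ↦ γ̂(-t)` is the natural parametrisation of that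
  pair (`IsNaturallyParametrized.reversePath`, rigidity of `𝒫(γ)` from `TwoSidedWholePlaneSLEProofs`).
* Reversal versus the symmetries of Cor. 4.7 (elementary, [folklore]): `reversePath` commutes with the
  dilations `dilatePath ν a` and intertwines the re-rootings, `reversePath ∘ reroot s = reroot (-s) ∘
  reversePath`; hence the reversal of a self-similar law is self-similar of the same index and the
  reversal of a law with stationary increments has stationary increments
  (`IsSelfSimilar.map_reversePath`, `IsRerootInvariant.map_reversePath`) — the two halves of Cor. 4.7
  are compatible with (i), as they must be.

## References

* D. Zhan, *SLE loop measures*, PTRF 179 (2021), arXiv:1702.08026 (arXiv numbering): §2.2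
  (two-sided whole-plane SLE_κ, reversibility (i)), Rem. 2.4, Cor. 4.7 and its proof.
  [Zhan2021SLELoopMeasures]
* J. Miller, S. Sheffield, *Imaginary geometry IV: interior rays, whole-plane reversibility, and
  space-filling trees*, PTRF 169 (2017), Thm 1.20. [MillerSheffield2013]
* D. Zhan, *Reversibility of chordal SLE*, Ann. Probab. 36 (2008). [Zhan2008Reversibility]
-/

noncomputable section

open Set Filter Topology MeasureTheory
open Literature.Probability.RandomPlanarGeometry.RootedCurve (reroot reroot_apply)
open scoped NNReal ENNReal

namespace Literature.Probability.RandomPlanarGeometry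

open scoped PathBorel

/-! ### Reversal versus the symmetries of Cor. 4.7 -/

section Symmetries

/-- Reversal commutes with the dilations: `(a^ν γ(·/a))(-t) = a^ν γ(-t/a)`. [folklore] -/
theorem reversePath_dilatePath (ν a : ℝ) (γ : C(ℝ, ℂ)) :
    reversePath (dilatePath ν a γ) = dilatePath ν a (reversePath γ) := by
  ext t
  simp [neg_div]

/-- Reversal intertwines the re-rootings: `reversePath (reroot s γ) = reroot (-s) (reversePath γ)`
(both are `t ↦ γ(s - t) - γ(s)`). [folklore] -/
theorem reversePath_reroot (s : ℝ) (γ : C(ℝ, ℂ)) :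
    reversePath (reroot s γ) = reroot (-s) (reversePath γ) := by
  ext t
  simp only [reversePath_apply, reroot_apply, neg_add_rev, neg_neg]
  congr 2
  ring

/-- The reversal of a self-similar law of index `ν` is self-similar of index `ν`. [folklore] -/
theorem IsSelfSimilar.map_reversePath {ν : ℝ} {μ : Measure C(ℝ, ℂ)} (h : IsSelfSimilar ν μ) :
    IsSelfSimilar ν (μ.map reversePath) := by
  intro a ha
  rw [Measure.map_map (measurable_dilatePath ν a) measurable_reversePath]
  have hfun : dilatePath ν a ∘ reversePath = reversePath ∘ dilatePath ν a :=
    funext fun γ ↦ (reversePath_dilatePath ν a γ).symm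
  rw [hfun, ← Measure.map_map measurable_reversePath (measurable_dilatePath ν a), h a ha]

/-- The reversal of a law with stationary increments (re-rooting invariant) has stationary
increments. [folklore] -/
theorem IsRerootInvariant.map_reversePath {μ : Measure C(ℝ, ℂ)} (h : IsRerootInvariant μ) :
    IsRerootInvariant (μ.map reversePath) := by
  intro s
  rw [Measure.map_map (measurable_reroot s) measurable_reversePath]
  have hfun : (reroot s : C(ℝ, ℂ) → C(ℝ, ℂ)) ∘ reversePath = reversePath ∘ reroot (-s) := by
    funext γ
    rw [Function.comp_apply, Function.comp_apply, reversePath_reroot, neg_neg]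
  rw [hfun, ← Measure.map_map measurable_reversePath (measurable_reroot (-s)), h (-s)]

end Symmetries

/-! ### The corrected statement of reversibility and its reductions -/

section Corrected

/-- **Reversibility of the two-sided whole-plane SLE_κ natural law — corrected statement, recorded as
the conclusion of a proved implication.** Zhan (2021), §2.2 (i): "the reversal of `γ` has the same law
(modulo a time change) as `γ`" for the two-sided whole-plane SLE_κ curve `γ` from `∞` to `∞` through
`0` (`κ ∈ (0, 8)`), transferred to the Minkowski content parametrisation rooted at `0` (Rem. 2.4,
proof of Cor. 4.7): invariance of the natural law under `reversePath`. The CONCLUSION of this theorem,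
`∀ κ μ, 0 < κ → κ < 8 → IsTwoSidedWholePlaneSLENatLawMeas κ μ → μ.map reversePath = μ`, is the corrected
statement of the named fact `IsTwoSidedWholePlaneSLENatLaw.map_reversePath` (to be vendored as the named
fact `IsTwoSidedWholePlaneSLENatLawMeas.map_reversePath` by a definition proposal); the theorem itself
only records that the misstated fact implies the corrected one (`IsTwoSidedWholePlaneSLENatLawMeas.toNatLaw`).
DISCREPANCY: `IsTwoSidedWholePlaneSLENatLaw.map_reversePath` carries the same conclusion over the larger
class `IsTwoSidedWholePlaneSLENatLaw κ` (non-measurable uniformizer selector allowed), which — granted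
existence of the two-sided curve — contains laws other than Zhan's `ν̂^#_{∞⇌0}` (module docstring); it
is thus stronger than the source. [cite: Zhan2021SLELoopMeasures, §2.2 (i)] -/
theorem IsTwoSidedWholePlaneSLENatLaw.map_reversePath_imp_meas
    (h : IsTwoSidedWholePlaneSLENatLaw.map_reversePath) :
    ∀ (κ : ℝ≥0) (μ : Measure C(ℝ, ℂ)), 0 < κ → κ < 8 → IsTwoSidedWholePlaneSLENatLawMeas κ μ →
      μ.map reversePath = μ :=
  fun κ μ hκ hκ' hμ ↦ h κ μ hκ hκ' hμ.toNatLaw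

/-- **Corrected reversibility from closure under reversal, given well-definedness** (the shape of the
transfer of Zhan (2021), §2.2 (i) to the natural parametrisation, Rem. 2.4 / proof of Cor. 4.7):
if the corrected class of natural laws (`0 < κ < 8`) is closed under `reversePath` (hypothesis `hcl`:
the reversed loop, re-timed by Minkowski content from its root `0`, is again a two-sided whole-plane
SLE_κ natural law) and two corrected natural laws for the same `κ` coincide (hypothesis `hu`, the
corrected form of `IsTwoSidedWholePlaneSLENatLaw.unique`), then every corrected natural law is
invariant under `reversePath`. [cite: Zhan2021SLELoopMeasures, §2.2 (i)] -/
theorem IsTwoSidedWholePlaneSLENatLawMeas.map_reversePath_of_unique_of_closed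
    (hu : ∀ (κ : ℝ≥0) (μ μ' : Measure C(ℝ, ℂ)),
      IsTwoSidedWholePlaneSLENatLawMeas κ μ → IsTwoSidedWholePlaneSLENatLawMeas κ μ' → μ = μ')
    (hcl : ∀ (κ : ℝ≥0) (μ : Measure C(ℝ, ℂ)), 0 < κ → κ < 8 →
      IsTwoSidedWholePlaneSLENatLawMeas κ μ → IsTwoSidedWholePlaneSLENatLawMeas κ (μ.map reversePath)) :
    ∀ (κ : ℝ≥0) (μ : Measure C(ℝ, ℂ)), 0 < κ → κ < 8 → IsTwoSidedWholePlaneSLENatLawMeas κ μ →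
      μ.map reversePath = μ :=
  fun κ μ hκ hκ' h ↦ hu κ _ _ (hcl κ μ hκ hκ' h) h

/-- Conversely, corrected reversibility contains the closure of the corrected class under reversal
(the reversal of a corrected natural law IS that law). [cite: Zhan2021SLELoopMeasures, §2.2 (i)] -/
theorem IsTwoSidedWholePlaneSLENatLawMeas.closed_of_map_reversePath_meas
    (hrev : ∀ (κ : ℝ≥0) (μ : Measure C(ℝ, ℂ)), 0 < κ → κ < 8 →
      IsTwoSidedWholePlaneSLENatLawMeas κ μ → μ.map reversePath = μ)
    (κ : ℝ≥0) (μ : Measure C(ℝ, ℂ)) (hκ : 0 < κ) (hκ' : κ < 8)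
    (h : IsTwoSidedWholePlaneSLENatLawMeas κ μ) :
    IsTwoSidedWholePlaneSLENatLawMeas κ (μ.map reversePath) := by
  rwa [hrev κ μ hκ hκ' h]

/-- Granted well-definedness of the corrected law, corrected reversibility is EQUIVALENT to the closure
of the corrected class under `reversePath`. [cite: Zhan2021SLELoopMeasures, §2.2 (i)] -/
theorem IsTwoSidedWholePlaneSLENatLawMeas.map_reversePath_meas_iff_closed_of_unique
    (hu : ∀ (κ : ℝ≥0) (μ μ' : Measure C(ℝ, ℂ)),
      IsTwoSidedWholePlaneSLENatLawMeas κ μ → IsTwoSidedWholePlaneSLENatLawMeas κ μ' → μ = μ') :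
    (∀ (κ : ℝ≥0) (μ : Measure C(ℝ, ℂ)), 0 < κ → κ < 8 → IsTwoSidedWholePlaneSLENatLawMeas κ μ →
        μ.map reversePath = μ) ↔
      ∀ (κ : ℝ≥0) (μ : Measure C(ℝ, ℂ)), 0 < κ → κ < 8 → IsTwoSidedWholePlaneSLENatLawMeas κ μ →
        IsTwoSidedWholePlaneSLENatLawMeas κ (μ.map reversePath) :=
  ⟨IsTwoSidedWholePlaneSLENatLawMeas.closed_of_map_reversePath_meas,
    IsTwoSidedWholePlaneSLENatLawMeas.map_reversePath_of_unique_of_closed hu⟩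

/-- **Closure under reversal from a reversed pair on the same space, corrected class** (the transfer
of Zhan (2021), §2.2 (i) to the Minkowski content parametrisation, Rem. 2.4 / proof of Cor. 4.7): if
`μ = law(γ̂)` for a random path `γ̂` that is almost surely naturally parametrised and rooted at `0`,
and the probability space carries a measurably uniformized two-sided whole-plane SLE_κ pair
`(η₁', η₂')` traced by the REVERSED path — `γ̂(-t)`, `t ≥ 0`, runs along `η₂'` and `γ̂(-t)`, `t < 0`,
along `η₁'`, through increasing time changes — then `t ↦ γ̂(-t)` is the natural parametrisation of
that pair, so `μ.map reversePath` is a corrected two-sided whole-plane SLE_κ natural law.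
[cite: Zhan2021SLELoopMeasures, §2.2 (i) / Rem. 2.4] -/
theorem isTwoSidedWholePlaneSLENatLawMeas_map_reversePath_of_reversedPair {κ : ℝ≥0}
    {μ : Measure C(ℝ, ℂ)} {Ω : Type} [MeasurableSpace Ω] {P : Measure Ω}
    {η₁' : Ω → ℝ → ℂ} {η₂' : Ω → ℝ≥0 → ℂ} {γ : Ω → C(ℝ, ℂ)} (hγm : Measurable γ)
    (hμ : μ = P.map γ)
    (hγ : ∀ᵐ ω ∂P, IsNaturallyParametrized (1 + (κ : ℝ) / 8) (γ ω) ∧ γ ω 0 = 0)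
    (hpair' : IsTwoSidedWholePlaneSLEPairMeas κ P η₁' η₂')
    (hrev : ∀ᵐ ω ∂P, (∃ e : ℝ≥0 ≃o ℝ≥0, ∀ t : ℝ≥0, γ ω (-(t : ℝ)) = η₂' ω (e t)) ∧
        (∃ e' : Iio (0 : ℝ) ≃o ℝ, ∀ t : Iio (0 : ℝ), γ ω (-(t : ℝ)) = η₁' ω (e' t))) :
    IsTwoSidedWholePlaneSLENatLawMeas κ (μ.map reversePath) := by
  refine ⟨Ω, ‹_›, P, η₁', η₂', fun ω ↦ reversePath (γ ω), hpair',
    measurable_reversePath.comp hγm, ?_, ?_⟩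
  · rw [hμ, Measure.map_map measurable_reversePath hγm]
    rfl
  · filter_upwards [hγ, hrev] with ω ⟨h1, h0⟩ ⟨h2, h3⟩
    exact ⟨h1.reversePath, by simpa using h0, by simpa using h2, by simpa using h3⟩

/-- **Corrected reversibility from reversibility at the level of arms, given well-definedness.**
Hypothesis `hrev` is Zhan's reversibility (i) of two-sided whole-plane SLE_κ (`0 < κ < 8`) phrased for
measurably uniformized arms: whenever `γ̂` is the natural parametrisation of a measurably uniformized
pair `(η₁, η₂)` on `(Ω, P)`, the same space carries a measurably uniformized pair `(η₁', η₂')` (first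
arm: the reversed second arm, a whole-plane SLE_κ(2) from `∞` to `0`; second arm: the reversed first
arm, chordal SLE_κ in the remaining domain) traced by `t ↦ γ̂(-t)` — Zhan (2021), §2.2: "From the
resampling property of two-sided radial SLE_κ, and the reversibility of whole-plane SLE_κ(2) and
chordal SLE_κ ([MS3, MS4, Zhan 2008]) … (i) the reversal of `γ` has the same law (modulo a time
change) as `γ`" (those inputs are not in the tree; `hrev` is a hypothesis, not a vendored fact).
Granted also the well-definedness of the corrected law (`hu`), the corrected reversibility statement
follows (`map_reversePath_of_unique_of_closed` and
`isTwoSidedWholePlaneSLENatLawMeas_map_reversePath_of_reversedPair`).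
[cite: Zhan2021SLELoopMeasures, §2.2 (i)] -/
theorem IsTwoSidedWholePlaneSLENatLawMeas.map_reversePath_of_reversedPairs
    (hu : ∀ (κ : ℝ≥0) (μ μ' : Measure C(ℝ, ℂ)),
      IsTwoSidedWholePlaneSLENatLawMeas κ μ → IsTwoSidedWholePlaneSLENatLawMeas κ μ' → μ = μ')
    (hrev : ∀ (κ : ℝ≥0), 0 < κ → κ < 8 → ∀ (Ω : Type) (_ : MeasurableSpace Ω) (P : Measure Ω)
      (η₁ : Ω → ℝ → ℂ) (η₂ : Ω → ℝ≥0 → ℂ) (γ : Ω → C(ℝ, ℂ)),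
      IsTwoSidedWholePlaneSLEPairMeas κ P η₁ η₂ → Measurable γ →
      (∀ᵐ ω ∂P, IsNaturallyParametrized (1 + (κ : ℝ) / 8) (γ ω) ∧ γ ω 0 = 0 ∧
        (∃ e : ℝ≥0 ≃o ℝ≥0, ∀ t : ℝ≥0, γ ω t = η₂ ω (e t)) ∧
        (∃ e' : Iio (0 : ℝ) ≃o ℝ, ∀ t : Iio (0 : ℝ), γ ω t = η₁ ω (e' t))) →
      ∃ (η₁' : Ω → ℝ → ℂ) (η₂' : Ω → ℝ≥0 → ℂ), IsTwoSidedWholePlaneSLEPairMeas κ P η₁' η₂' ∧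
        ∀ᵐ ω ∂P, (∃ e : ℝ≥0 ≃o ℝ≥0, ∀ t : ℝ≥0, γ ω (-(t : ℝ)) = η₂' ω (e t)) ∧
          (∃ e' : Iio (0 : ℝ) ≃o ℝ, ∀ t : Iio (0 : ℝ), γ ω (-(t : ℝ)) = η₁' ω (e' t))) :
    ∀ (κ : ℝ≥0) (μ : Measure C(ℝ, ℂ)), 0 < κ → κ < 8 → IsTwoSidedWholePlaneSLENatLawMeas κ μ →
      μ.map reversePath = μ := by
  refine IsTwoSidedWholePlaneSLENatLawMeas.map_reversePath_of_unique_of_closed hu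
    fun κ μ hκ hκ' hμ ↦ ?_
  obtain ⟨Ω, _, P, η₁, η₂, γ, hpair, hγm, hμ, hclauses⟩ := hμ
  obtain ⟨η₁', η₂', hpair', hrev'⟩ := hrev κ hκ hκ' Ω ‹_› P η₁ η₂ γ hpair hγm hclauses
  exact isTwoSidedWholePlaneSLENatLawMeas_map_reversePath_of_reversedPair hγm hμ
    (hclauses.mono fun ω h ↦ ⟨h.1, h.2.1⟩) hpair' hrev'

end Corrected

end Literature.Probability.RandomPlanarGeometry
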